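import Mathlib
import HarnessLib
import Summits.NavierStokesRegularity.NavierStokesRegularity.Theorems.HalfSpaceWindowDoorCirculationCarryingRigidityGaussExtremal

/-!
# Route `HalfSpaceWindowDoor`, crux `CirculationCarryingRigidity` (stmt-NavierStokesRegularity-25311) —
# the Gaussian-extremal normal form over the FULL CHARACTERISTIC FAMILY (every apex `s₀ ≤ 0`, every scale)

LEAD ns-hsw-p1 g7 (cell pub-ns-dss), `--supports stmt-NavierStokesRegularity-25311 --as helper`; sequel of `…GaussExtremal` (p668297),
whose normal form maximises the scale-invariant Gaussian angular momentum over the apex-`0` characteristics `t = −τ` only.  Backward time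
shifts stay in the door class (`IsTypeIAncientMild.comp_sub_right`), so every backward characteristic with apex `s₀ = τ + t ≤ 0` is
realised inside the class; taking the supremum over the whole family `{𝒢(t; x₀)[v(τ)] : τ < 0, 0 < t ≤ −τ, x₀}` and zooming the
time-SHIFTED profile about the maximising axes gives:

* `abs_gaussAngMom_le_of_le_neg` — `|𝒢(t; x₀)[v(τ)]| ≤ c₀ C` on the whole family;
* `exists_gaussExtremal'` — an enemy of W6 yields a closed-hemisphere door-class `W` with `Λ = 𝒢(1;0)[W(−1)] > 0` maximal against
  EVERY time `σ < 0`, EVERY scale `0 < t ≤ −σ` and every axis, and with maximal inflow `ℐ(1;0)[W(−1)] = −2Λ`;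
* `hemisphereLiouvilleE3_of_noGaussExtremal'`, `circulationCarryingRigidity_of_noGaussExtremal'` — the corresponding (stronger)
  reductions of W6 and of the crux.

The extra one-sided SCALE maximality `𝒢(t;0)[W(−1)] ≤ 𝒢(1;0)[W(−1)]`, `0 < t ≤ 1`, reads infinitesimally `∂_t[t·e^{tΔ}ω₃](0)|_{t=1} ≥ 0`,
i.e. `−Θ ≤ ΔΘ` at `(1, 0)` for `Θ = e^{tΔ}ω₃(−1)`; with the axis maximality (`ΔΘ ≤ 0`) this pins `2 ≤ ⟨|x|²⟩_{Gω₃} ≤ 6` at the extremal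
point (untyped consequences; card `Lines/blowdown.md`).

WHAT THIS IS NOT: not a statement about Navier–Stokes regularity; door statements concern HYPOTHETICAL blow-up profiles.  No item is
closed by this file.
-/

noncomputable section

-- the summit and its single sub-problem share the name (CONVENTIONS §1), as in every Theorems file
set_option linter.dupNamespace false

namespace Summit.NavierStokesRegularity.NavierStokesRegularity.Theorems.HalfSpaceWindowDoorCirculationCarryingRigidityGaussExtremalFamily

open MeasureTheory Set Function Filter Topology
open scoped RealInnerProductSpace InnerProductSpace
open Literature.Analysis Literature.Analysis.FluidPDE
open Summit.NavierStokesRegularity.NavierStokesRegularity.Theses.HalfSpaceWindowDoor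
open Summit.NavierStokesRegularity.NavierStokesRegularity.Theorems.HalfSpaceWindowDoorCirculationCarryingRigidityDefs
open Summit.NavierStokesRegularity.NavierStokesRegularity.Theorems.HalfSpaceWindowDoorCirculationCarryingRigidityReduction
  (circulationCarryingRigidity_of_hemisphereLiouvilleE3)
open Summit.NavierStokesRegularity.NavierStokesRegularity.Theorems.HalfSpaceWindowDoorCirculationCarryingRigidityGaussBlowdown
  (gaussAngMom_zoom tendsto_gaussAngMom)
open Summit.NavierStokesRegularity.NavierStokesRegularity.Theorems.HalfSpaceWindowDoorCirculationCarryingRigidityGaussCirculation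
  (gaussianCirculation_holds)
open Summit.NavierStokesRegularity.NavierStokesRegularity.Theorems.HalfSpaceWindowDoorCirculationCarryingRigidityHorizontalVorticityFloor
  (tendsto_curl_of_tendsto_fderiv)
open Summit.NavierStokesRegularity.NavierStokesRegularity.Theorems.PoloidalWindowDoorPoloidalWindowRigidityWindow
  (isTypeIAncientMild_of_class)
open Summit.NavierStokesRegularity.NavierStokesRegularity.Theorems
  (exists_tendsto_of_isTypeIAncientMild_seq isTypeIAncientMild_zoom zoom_apply)
open Summit.NavierStokesRegularity.NavierStokesRegularity.Theorems.HalfSpaceWindowDoorCirculationCarryingRigidityGaussExtremal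
  (inDoorClass_of_isTypeIAncientMild gaussInflow_eq_of_isLocalMax)

variable {C : ℝ}

/-! ### Maximality over ALL backward characteristics (apex `s₀ ≤ 0`, every scale)

The family of scale-invariant Gaussian angular momenta of a door-class profile is larger than the apex-`0` family used above:
every backward characteristic with apex `s₀ ≤ 0` is realised inside the class by a backward time shift (`comp_sub_right`).  Taking
the supremum over the whole family `{𝒢(t; x₀)[v(τ)] : τ < 0, 0 < t ≤ −τ, x₀}` and zooming the time-SHIFTED profile gives an extremal
`W` which is maximal against every scale `0 < t ≤ −σ` at every time `σ < 0` and every axis — in particular the one-sided SCALE condition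
`𝒢(t; 0)[W(−1)] ≤ 𝒢(1; 0)[W(−1)]` for `0 < t ≤ 1` (infinitesimally: `∂_t[t·e^{tΔ}ω₃](0)|_{t=1} ≥ 0`, i.e. `−Θ ≤ ΔΘ` for
`Θ = e^{tΔ}ω₃(−1)` at `(1,0)`, to be combined with `ΔΘ ≤ 0` from the axis maximality; untyped consequences in the card
`Lines/blowdown.md`). -/

open Summit.NavierStokesRegularity.NavierStokesRegularity.Theorems.HalfSpaceWindowDoorCirculationCarryingRigidityGaussBlowdown
  (abs_gaussAngMom_le_of_norm_le) in
/-- **Uniform bound on the whole characteristic family.**  On the door class, `|𝒢(t; x₀)[v(τ)]| ≤ c₀ C` for all `τ < 0`,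
`0 < t ≤ −τ`, `x₀`. -/
theorem abs_gaussAngMom_le_of_le_neg {v : ℝ → EuclideanSpace ℝ (Fin 3) → EuclideanSpace ℝ (Fin 3)} (hrate : HasTypeITimeDecay C v)
    {τ t : ℝ} (hτ : τ < 0) (ht : 0 < t) (htτ : t ≤ -τ) (x₀ : EuclideanSpace ℝ (Fin 3)) :
    |gaussAngMom t x₀ (v τ)| ≤ (4 * Real.pi) ^ ((3 : ℝ) / 2) * 2 * (2 * (2 : ℝ) ^ ((3 : ℝ) / 2)) * C := by
  have hτ0 : 0 < -τ := neg_pos.2 hτ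
  have hC : 0 ≤ C := by
    have h := hrate (-1) (by norm_num) 0
    have h1 : Real.sqrt (-(-1 : ℝ)) = 1 := by norm_num
    rw [h1, div_one] at h
    exact (norm_nonneg _).trans h
  have hsq : 0 < Real.sqrt (-τ) := Real.sqrt_pos.2 hτ0
  have h := abs_gaussAngMom_le_of_norm_le ht (div_nonneg hC hsq.le) (fun x => hrate τ hτ x) x₀
  have hst : t ^ (1 / 2 : ℝ) ≤ Real.sqrt (-τ) := by
    rw [← Real.sqrt_eq_rpow]; exact Real.sqrt_le_sqrt htτ
  calc |gaussAngMom t x₀ (v τ)|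
      ≤ (4 * Real.pi) ^ ((3 : ℝ) / 2) * 2 * (2 * (2 : ℝ) ^ ((3 : ℝ) / 2)) * (C / Real.sqrt (-τ)) * t ^ (1 / 2 : ℝ) := h
    _ ≤ (4 * Real.pi) ^ ((3 : ℝ) / 2) * 2 * (2 * (2 : ℝ) ^ ((3 : ℝ) / 2)) * (C / Real.sqrt (-τ)) * Real.sqrt (-τ) :=
        mul_le_mul_of_nonneg_left hst (by positivity)
    _ = (4 * Real.pi) ^ ((3 : ℝ) / 2) * 2 * (2 * (2 : ℝ) ^ ((3 : ℝ) / 2)) * C := by field_simp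

/-- **GAUSSIAN-EXTREMAL NORMAL FORM, full characteristic family.**  If some closed-hemisphere door-class profile (Type-I constant
`C`) has `⟪curl v(s₁)(y₁), e₃⟫ > 0` somewhere, then there is a closed-hemisphere door-class profile `W` (same `C`) whose Gaussian
angular momentum `𝒢(t; y₀)[W(σ)]` — over ALL times `σ < 0`, ALL scales `0 < t ≤ −σ` (every backward characteristic with apex
`σ + t ≤ 0`) and all axes `y₀` — is maximal at `(t, σ, y₀) = (1, −1, 0)`, with value `Λ = 𝒢(1;0)[W(−1)] > 0` and maximal inflow
`ℐ(1;0)[W(−1)] = −2Λ`. -/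
theorem exists_gaussExtremal' {v : ℝ → EuclideanSpace ℝ (Fin 3) → EuclideanSpace ℝ (Fin 3)} (hv : InDoorClass C v)
    (hsign : SignE3 v) (hpos : ∃ s < 0, ∃ y, 0 < ⟪curl (v s) y, e3⟫) :
    ∃ W : ℝ → EuclideanSpace ℝ (Fin 3) → EuclideanSpace ℝ (Fin 3), InDoorClass C W ∧ SignE3 W ∧
      0 < gaussAngMom 1 0 (W (-1)) ∧
      (∀ σ < 0, ∀ t : ℝ, 0 < t → t ≤ -σ → ∀ y₀, gaussAngMom t y₀ (W σ) ≤ gaussAngMom 1 0 (W (-1))) ∧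
      gaussInflow 1 0 (W (-1)) = -2 * gaussAngMom 1 0 (W (-1)) := by
  obtain ⟨hrate, hcont, hmild, hdiv⟩ := hv
  have hA : IsTypeIAncientMild C v := isTypeIAncientMild_of_class hrate hcont hmild hdiv
  -- the full family of scale-invariant Gaussian angular momenta (all backward characteristics with apex `≤ 0`)
  set S : Set ℝ := {m | ∃ τ : ℝ, τ < 0 ∧ ∃ t : ℝ, 0 < t ∧ t ≤ -τ ∧ ∃ x₀ : EuclideanSpace ℝ (Fin 3),
    m = gaussAngMom t x₀ (v τ)} with hS
  have hSbdd : BddAbove S := by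
    refine ⟨(4 * Real.pi) ^ ((3 : ℝ) / 2) * 2 * (2 * (2 : ℝ) ^ ((3 : ℝ) / 2)) * C, ?_⟩
    rintro m ⟨τ, hτ, t, ht, htτ, x₀, rfl⟩
    exact (le_abs_self _).trans (abs_gaussAngMom_le_of_le_neg hrate hτ ht htτ x₀)
  obtain ⟨s₁, hs₁, y₁, hy₁⟩ := hpos
  have hmem₁ : gaussAngMom (-s₁) y₁ (v s₁) ∈ S := ⟨s₁, hs₁, -s₁, neg_pos.2 hs₁, le_rfl, y₁, rfl⟩
  have hSne : S.Nonempty := ⟨_, hmem₁⟩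
  set Λ : ℝ := sSup S with hΛ
  have hpos₁ : 0 < gaussAngMom (-s₁) y₁ (v s₁) := by
    obtain ⟨hnn, hzero⟩ := gaussianCirculation_holds C v ⟨hrate, hcont, hmild, hdiv⟩ hsign y₁ (-s₁) s₁ (neg_pos.2 hs₁) hs₁
    rcases hnn.lt_or_eq with h | h
    · exact h
    · exact absurd (hzero h.symm y₁) hy₁.ne'
  have hΛpos : 0 < Λ := lt_of_lt_of_le hpos₁ (le_csSup hSbdd hmem₁)
  have hleΛ : ∀ τ < 0, ∀ t : ℝ, 0 < t → t ≤ -τ → ∀ x₀, gaussAngMom t x₀ (v τ) ≤ Λ := fun τ hτ t ht htτ x₀ =>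
    le_csSup hSbdd ⟨τ, hτ, t, ht, htτ, x₀, rfl⟩
  -- a maximising sequence `(τ_n, t_n, x_n)`
  obtain ⟨m, -, hmlim, hmS⟩ := exists_seq_tendsto_sSup hSne hSbdd
  have hch : ∀ n, ∃ q : (ℝ × ℝ) × EuclideanSpace ℝ (Fin 3), q.1.1 < 0 ∧ 0 < q.1.2 ∧ q.1.2 ≤ -q.1.1 ∧
      m n = gaussAngMom q.1.2 q.2 (v q.1.1) := by
    intro n
    obtain ⟨τ, hτ, t, ht, htτ, x₀, h⟩ := hmS n
    exact ⟨((τ, t), x₀), hτ, ht, htτ, h⟩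
  choose q hqτ hqt hqtτ hmq using hch
  set τn : ℕ → ℝ := fun n => (q n).1.1 with hτn
  set tn : ℕ → ℝ := fun n => (q n).1.2 with htn
  set xn : ℕ → EuclideanSpace ℝ (Fin 3) := fun n => (q n).2 with hxn
  -- backward shifts `δ_n = -(τ_n + t_n) ≥ 0` and zooms `λ_n = √t_n`
  set δ : ℕ → ℝ := fun n => -(τn n + tn n) with hδ
  have hδ0 : ∀ n, 0 ≤ δ n := fun n => by simp only [hδ]; linarith [hqtτ n]
  set lam : ℕ → ℝ := fun n => Real.sqrt (tn n) with hlam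
  have hlam0 : ∀ n, 0 < lam n := fun n => Real.sqrt_pos.2 (hqt n)
  have hlam2 : ∀ n, lam n ^ 2 = tn n := fun n => Real.sq_sqrt (hqt n).le
  set vs : ℕ → ℝ → EuclideanSpace ℝ (Fin 3) → EuclideanSpace ℝ (Fin 3) := fun n σ => v (σ - δ n) with hvs
  have hvscl : ∀ n, IsTypeIAncientMild C (vs n) := fun n => hA.comp_sub_right (hδ0 n)
  set w : ℕ → ℝ → EuclideanSpace ℝ (Fin 3) → EuclideanSpace ℝ (Fin 3) :=
    fun n => lam n • stPull (lam n ^ 2) (lam n) 0 (xn n) (vs n) with hw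
  have hwcl : ∀ n, IsTypeIAncientMild C (w n) := fun n => isTypeIAncientMild_zoom (hvscl n) (hlam0 n) (xn n)
  have hw_fun : ∀ n σ, w n σ = fun z => lam n • v (lam n ^ 2 * σ - δ n) (xn n + lam n • z) := fun n σ =>
    funext fun z => zoom_apply (lam n) (xn n) (vs n) σ z
  -- zoom invariance on the characteristic family
  have hwG : ∀ n, ∀ σ < 0, ∀ t : ℝ, 0 < t → ∀ y₀, gaussAngMom t y₀ (w n σ) =
      gaussAngMom (lam n ^ 2 * t) (xn n + lam n • y₀) (v (lam n ^ 2 * σ - δ n)) := by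
    intro n σ hσ t ht y₀
    rw [hw_fun, gaussAngMom_zoom (hlam0 n) ht (xn n) y₀ (v (lam n ^ 2 * σ - δ n))]
  have hwGle : ∀ n, ∀ σ < 0, ∀ t : ℝ, 0 < t → t ≤ -σ → ∀ y₀, gaussAngMom t y₀ (w n σ) ≤ Λ := by
    intro n σ hσ t ht htσ y₀
    rw [hwG n σ hσ t ht y₀]
    have hl2 : 0 < lam n ^ 2 := pow_pos (hlam0 n) 2
    refine hleΛ _ ?_ _ (mul_pos hl2 ht) ?_ _
    · have := mul_neg_of_pos_of_neg hl2 hσ; linarith [hδ0 n]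
    · have h1 : lam n ^ 2 * t ≤ lam n ^ 2 * (-σ) := mul_le_mul_of_nonneg_left htσ hl2.le
      linarith [hδ0 n]
  have hwG1 : ∀ n, gaussAngMom 1 0 (w n (-1)) = m n := by
    intro n
    have e2 : lam n ^ 2 * (-1) - δ n = τn n := by simp only [hδ]; rw [hlam2]; ring
    rw [hwG n (-1) (by norm_num) 1 one_pos 0, hmq n, smul_zero, add_zero, mul_one, e2, hlam2]
  -- compactness
  obtain ⟨φ, hφ, W, hW, hpt, hptG, -, -⟩ := exists_tendsto_of_isTypeIAncientMild_seq C hwcl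
  have hWdoor : InDoorClass C W := inDoorClass_of_isTypeIAncientMild hW
  have hGlim : ∀ σ < 0, ∀ t : ℝ, 0 < t → ∀ y₀,
      Tendsto (fun j => gaussAngMom t y₀ (w (φ j) σ)) atTop (𝓝 (gaussAngMom t y₀ (W σ))) := by
    intro σ hσ t ht y₀
    exact tendsto_gaussAngMom (B := C / Real.sqrt (-σ)) ht (fun j => (hwcl (φ j)).continuous_slice hσ)
      (fun j x => (hwcl (φ j)).norm_le hσ x) (fun x => hpt σ hσ x) y₀
  have hG1 : gaussAngMom 1 0 (W (-1)) = Λ := by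
    have h1 := hGlim (-1) (by norm_num) 1 one_pos 0
    have h2 : Tendsto (fun j => gaussAngMom 1 0 (w (φ j) (-1))) atTop (𝓝 Λ) := by
      refine (hmlim.comp hφ.tendsto_atTop).congr fun j => ?_
      simp only [Function.comp_apply, hwG1]
    exact tendsto_nhds_unique h1 h2
  have hGle : ∀ σ < 0, ∀ t : ℝ, 0 < t → t ≤ -σ → ∀ y₀, gaussAngMom t y₀ (W σ) ≤ Λ := fun σ hσ t ht htσ y₀ =>
    le_of_tendsto' (hGlim σ hσ t ht y₀) fun j => hwGle (φ j) σ hσ t ht htσ y₀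
  -- the sign passes to the limit
  have hWsign : SignE3 W := by
    intro σ hσ y
    have hc : Tendsto (fun j => ⟪curl (w (φ j) σ) y, e3⟫) atTop (𝓝 ⟪curl (W σ) y, e3⟫) :=
      (tendsto_curl_of_tendsto_fderiv (hptG σ hσ y)).inner tendsto_const_nhds
    refine ge_of_tendsto' hc fun j => ?_
    have hcurl : curl (w (φ j) σ) y =
        (lam (φ j) * lam (φ j)) • curl (vs (φ j) (0 + lam (φ j) ^ 2 * σ)) (xn (φ j) + lam (φ j) • y) :=
      curl_smul_stPull (lam (φ j)) (lam (φ j) ^ 2) (lam (φ j)) 0 (xn (φ j)) (vs (φ j)) σ y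
    rw [hcurl, real_inner_smul_left]
    refine mul_nonneg (mul_self_nonneg _) (hsign _ ?_ _)
    have := mul_neg_of_pos_of_neg (pow_pos (hlam0 (φ j)) 2) hσ
    linarith [hδ0 (φ j)]
  -- Fermat on the characteristic through the apex
  have hmax : IsLocalMax (fun σ : ℝ => gaussAngMom (-σ) 0 (W σ)) (-1) := by
    filter_upwards [Iio_mem_nhds (show (-1 : ℝ) < 0 by norm_num)] with σ hσ
    rw [neg_neg, hG1]
    exact hGle σ hσ (-σ) (neg_pos.2 hσ) le_rfl 0
  have hI := gaussInflow_eq_of_isLocalMax hWdoor hmax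
  refine ⟨W, hWdoor, hWsign, ?_, ?_, hI⟩
  · rw [hG1]; exact hΛpos
  · intro σ hσ t ht htσ y₀
    rw [hG1]
    exact hGle σ hσ t ht htσ y₀

/-- **REDUCTION, full family.**  W6 follows from «no closed-hemisphere door-class profile is Gaussian-extremal over the whole
characteristic family (all `σ < 0`, `0 < t ≤ −σ`, `y₀`) with maximal inflow `ℐ(1;0)[W(−1)] = −2𝒢(1;0)[W(−1)]`» — a weaker hypothesis
than in `hemisphereLiouvilleE3_of_noGaussExtremal` (the refuter may use the scale maximality too). -/
theorem hemisphereLiouvilleE3_of_noGaussExtremal'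
    (h : ∀ (C : ℝ) (W : ℝ → EuclideanSpace ℝ (Fin 3) → EuclideanSpace ℝ (Fin 3)), InDoorClass C W → SignE3 W →
      0 < gaussAngMom 1 0 (W (-1)) →
      (∀ σ < 0, ∀ t : ℝ, 0 < t → t ≤ -σ → ∀ y₀, gaussAngMom t y₀ (W σ) ≤ gaussAngMom 1 0 (W (-1))) →
      gaussInflow 1 0 (W (-1)) = -2 * gaussAngMom 1 0 (W (-1)) → False) :
    HemisphereLiouvilleE3 := by
  intro C v hrate hcont hmild hdiv hsign s hs y
  by_contra hne
  have hpos : 0 < ⟪curl (v s) y, e3⟫ := lt_of_le_of_ne (hsign s hs y) (Ne.symm hne)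
  obtain ⟨W, hW, hWs, hΛ, hmax, hI⟩ :=
    exists_gaussExtremal' (C := C) ⟨hrate, hcont, hmild, hdiv⟩ hsign ⟨s, hs, y, hpos⟩
  exact h C W hW hWs hΛ hmax hI

/-- **The crux from the full-family normal form.** -/
theorem circulationCarryingRigidity_of_noGaussExtremal'
    (h : ∀ (C : ℝ) (W : ℝ → EuclideanSpace ℝ (Fin 3) → EuclideanSpace ℝ (Fin 3)), InDoorClass C W → SignE3 W →
      0 < gaussAngMom 1 0 (W (-1)) →
      (∀ σ < 0, ∀ t : ℝ, 0 < t → t ≤ -σ → ∀ y₀, gaussAngMom t y₀ (W σ) ≤ gaussAngMom 1 0 (W (-1))) →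
      gaussInflow 1 0 (W (-1)) = -2 * gaussAngMom 1 0 (W (-1)) → False) :
    CirculationCarryingRigidity :=
  circulationCarryingRigidity_of_hemisphereLiouvilleE3 (hemisphereLiouvilleE3_of_noGaussExtremal' h)

end Summit.NavierStokesRegularity.NavierStokesRegularity.Theorems.HalfSpaceWindowDoorCirculationCarryingRigidityGaussExtremalFamily

end
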